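import Summits.QuantumFields.YangMills.Theses.RenyiTelescope

/-!
# Assembly of route `RenyiTelescope` (rung R3 of LADDER-YM; ideator seat ym-r3-idea-2 g3, LINE 6)

The route file's kernel-checked deciding theorem `closes` packaged as the proof of the route's `Assembly` item:
`MinimiserStabilityRegPr → FluctuationComparisonRegPrIntL → CutoffRenyiL → FineRegimeUnitTailL →
HistoryTailOfRenyiTelescope → YM3TorusSU2`.
No summit and no Clay statement is proved here; the rung `YM3TorusSU2` itself stays open behind the open cruxes
(`CutoffRenyiL`, `FineRegimeUnitTailL` new; `MinimiserStabilityRegPr` / `FluctuationComparisonRegPrIntL` the parent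
route's residuals) and the support `HistoryTailOfRenyiTelescope`.
-/

namespace Summit.QuantumFields.YangMills.Theorems

open Summit.QuantumFields.YangMills.Theses.RenyiTelescope in
/-- The `Assembly` item of route `RenyiTelescope` holds: it is the route's deciding theorem `closes` read as an implication. -/
theorem renyiTelescope_assembly : Summit.QuantumFields.YangMills.Theses.RenyiTelescope.Assembly :=
  -- The REPAIR of 2026-08-28T10:59Z re-keyed the route's `closes` to `CutoffRenyiLR` / `HistoryTailOfRenyiTelescopeR`; this item's
  -- statement still reads the ORIGINAL chain (`CutoffRenyiL`, `HistoryTailOfRenyiTelescope`), so the pre-repair glue is inlined: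
  -- the parent route's deciding theorem applied to the history tail `hG hR hF`. Statement unchanged.
  fun h200 h201 hR hF hG => Summit.QuantumFields.YangMills.Theses.UnitScaleTilt.closes h200 h201 (hG hR hF)

end Summit.QuantumFields.YangMills.Theorems
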